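import Summits.Schanuel.Schanuel.Theorems.RootDecomp1KExhibitDescent02

/-!
# RootDecomp1KExhibitDescent — lens 1, generation 69, NODE 29 «BOTH EXHIBITS OF RECORD FALL TO DESCENT» (×0-AS-RECORD, PRICE L3091; ERRATUM E6; CLAIM L3089, NODE L3094, VERDICT L3096): ρ1′ = `rho1'` = (Y + 1)(Y³ + x) − 17x² LEVEL-EMPTY for N ≥ 4 by the coprime SPLIT DESCENT + the digit mod 32 (class `splitC t c = (Y + t)(Y³ + x) − c·x²`, t = ±2^i, c an odd prime ≢ 1 mod 32: `no_level_splitC`, `thinFibreAt_rho1'`) and ρ2′ = `rho2'` = (Y² − 17x)² − x(Y + 1) LEVEL-FINITE by the SQUARE DESCENT p_N = □ + the tree's x-linear Ridout member (class `sqTopC c a b = (Y² − c·x)² + x(aY + b)`, c odd, b ≠ 0: `levelSet_sqTopC_subset ⊆ {N < 2} ∪ SqLevels b c`, `thinFibreAt_rho2'`); exhibits of record VACANT thereafter — continuation (RootDecomp1KExhibitDescent03): §4  HEADLINE — both exhibits of record (ERRATUM E5, VERDICT 28) are typed residue members AND thin — 7 declarations `bev_rho2'_sq` … `exhibits_dec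ided`

(lens-1 g69 NODE 29 «BOTH EXHIBITS OF RECORD FALL TO DESCENT» L3094: HOME kernel K = HOME/decomp-schanuel-lens-1/g69/lean/ExhibitDescent.lean sha256 b5df7c6e…, 777 l, 53 decls (50 theorems + 3 defs `splitC` / `SqLevels` / `sqTopC`), ONE namespace `Summit.Schanuel.Schanuel.Theorems.RootDecomp1KExhibitDescent`, imports the tree port …RootDecomp1KResidueDescent04 ONLY (node 28's record port; `rho1'` / `rho2'` / `residue_rho1'` / `residue_rho2'` / `pow_eight_mod` / `cube_mod` / `level_exponent` / `two_pow_dvd_psNumer_sub_one` / `levelFinite_xLinear` BY TREE NAME); no private / instance / set_option / notation / sorry / new axiom / binder, `decide` only on small literals; lens farm rc 0 · 0 errors · 0 sorries · 53 dupNamespace, `--axioms` standard ×20, Probe g69/out/Probe.lean 62ee5499… rc 0 (control ProbeCtrl rc 1 as it must), memo g69/NODE-g69.md; CLAIM L3089 (ASK-FIRST under K-R58 (iii)); crit g12 PRICE L3091: ×0-AS-RECORD («ρ1′ lever = DESCENT ∪ LOCAL SIEVING; ρ2′ lever = DESCENT ∪ the tree's isSquare_mul_psNumer_finite — a toolkit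 member»), CHECKLIST K-g69 (G1)–(G5) + (S), ERRATUM E6 PRE-ANNOUNCED ((E6-a) the census K-R51 (ii) descent-datum keys = the admission screen for exhibits; (E6-b) ρ1′ / ρ2′ leave the exhibit list at this port — exhibits VACANT; (E6-d) the critic's own erratum on VERDICT 28), W-29-1 (genus ≥ 2 guidance); writer g36 pre-check NOTE 1 L3093 (40/40); census INSTRUMENT NOTE 45 L3090 (the LIVENESS-v38/v39 keys on ρ1′ / ρ2′: jroot(3) not excluded, tors ∣ 3 / j2rat SOME, tors ∣ 4 — «K-R51 certificate INCOMPLETE» at nomination); (G2) deviation of record: K proves `isSquare_mul_psNumer_finite'` from the TREE's `levelFinite_xLinear (X^2) (−C e)` because the tree's `isSquare_mul_psNumer_finite` (DegreeLadder09) is outside the import closure; crit g12 VERDICT 29 L3096: «×0-AS-RECORD — BOOKED (no credit: exhibits, classes, cores); CHECKLIST K-g69 (G1)–(G5) + (S) MET, the (G2) deviation ACCEPTED; ERRATUM E6 — FIXED ((E6-a) the census descent-datum keys = the admission screen, with the census precision: xdeg-2 rows = the K-R51 (ii) battery ∧ not bi-pure ∧ DomZero ∧ typed ρ1/ρ2 residue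 member, xdeg ≥ 3 rows need the kit jac first; (E6-b) ρ1′ / ρ2′ LEAVE the exhibit list at this port and JOIN the unconditional part, EXHIBITS OF RECORD := VACANT (ρ1: vacant · ρ2: vacant); (E6-c) standing-witness ledger and tally UNCHANGED; (E6-d) the critic own erratum on VERDICT 28); TOOLKIT ∪= split descent {isCoprime_split, core_split, …splitC} and square descent {core_sq, level_sq_cases, SqLevels, …sqTopC, isSquare_mul_psNumer_finite′}; e29-1; PORT GO (STAGING NOTE 27 plan APPROVED AS STAGED)»; lens g69 RESULT/DONE L3097. Port by census-1 gen 25 as `RootDecomp1KExhibitDescent01–03` (files ≤ 400 lines; `--supports stmt-Schanuel-33364`, the item stays OPEN; ×0 record port, no credit anywhere; UNCONDITIONAL PART ∪= these names; E6: exhibits VACANT): 01 = K l.1–391 of the prepped source (opens §1 / §2) — 10 decls `int_eq6`, `shape6`, `noOddPrimeFactor_one`, …, `levelFinite_split`; 02 = K l.392–721 of the prepped source (opens # The exhibit of record ρ1′ = `rho1'` = `S(1,17)` = `(Y + 1)(Y³ + x) − 17·x²` — DECIDED / §3 / # The exhibit of record ρ2′ = `rho2'` = `Q(17,−1,−1)`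 = `(Y² − 17x)² − x·Y − x` — DECIDED) — 36 decls `thinFibreAt_split`, `splitC`, `splitC_zero`, …, `rho2'_eq_sqTopC`; 03 = K l.722–774 of the prepped source (opens §4) — 7 decls `bev_rho2'_sq`, `levelSet_rho2'_subset`, `levelFinite_rho2'`, …, `exhibits_decided`. 0 one-line docstrings synthesised for undocumented helper declarations (statements quoted); everything else = K VERBATIM (statements, names, proofs, K's module docstring kept in part 01 below this provenance block).)
-/

noncomputable section

namespace Summit.Schanuel.Schanuel.Theorems.RootDecomp1KExhibitDescent

open Polynomial LiouvilleNumber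
open scoped Nat
open Summit.Schanuel.Schanuel.Theorems.RootDecomp1KTwoBaseCell (psNumer partialSum_eq_psNumer_div coprime_psNumer)
open Summit.Schanuel.Schanuel.Theorems.RootDecomp1KDegreeLadder
open Summit.Schanuel.Schanuel.Theorems.RootDecomp1KXLinear (xLinP bev_xLinP thinFibreAt_xLinear)
open Summit.Schanuel.Schanuel.Theorems.RootDecomp1KXTop
open Summit.Schanuel.Schanuel.Theorems.RootDecomp1KLevelFinite
open Summit.Schanuel.Schanuel.Theorems.RootDecomp1KOddEmpty (levelFinite_of_no_level)
open Summit.Schanuel.Schanuel.Theorems.RootDecomp1KHeightGrading (BddLevelEmpty bddLevelEmpty_iff_levelFinite)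
open Summit.Schanuel.Schanuel.Theorems.RootDecomp1KDigitPincer (odd_psNumer_two two_pow_dvd_of_dvd_mul_odd)
open Summit.Schanuel.Schanuel.Theorems.RootDecomp1KTrinomialDescent (partialSum_two_eq_int_div)
open Summit.Schanuel.Schanuel.Theorems.RootDecomp1KRunge (psNumer_pos_runge)
open Summit.Schanuel.Schanuel.Theorems.RootDecomp1KSectorTheorem (Residue SectorCond rho1 rho2 levelFinite_xLinear
  levelFinite_of_thinFibreAt_zero)
open Summit.Schanuel.Schanuel.Theorems.RootDecomp1KResidueDescent

/-- ρ2′ presents the square class with `c = 17`, `a = b = −1`. -/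
theorem bev_rho2'_sq (x y : ℝ) :
    bev (xPolyP 2 rho2') x y = y ^ 4 - 2 * ((17 : ℤ) : ℝ) * x * y ^ 2 + ((-1 : ℤ) : ℝ) * x * y
      + ((-1 : ℤ) : ℝ) * x + ((17 : ℤ) : ℝ) ^ 2 * x ^ 2 := by
  rw [bev_rho2']; push_cast; ring

/-- **(G2) `(C : ℝ) : LevelSet (xPolyP 2 rho2') C ⊆ {N | N < 2} ∪ {N | IsSquare (psNumer 2 N)}`** — a level point of
ρ2′ at a level `N ≥ 2` makes `p_N` a perfect square (hypothesis-free; note `p_3 = psNumer 2 3 = 81 = 9²`: the square set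
`{0, 3, …}` is FINITE — `isSquare_mul_psNumer_finite'` — not empty; LEVEL-FINITE is what is claimed). -/
theorem levelSet_rho2'_subset (C : ℝ) :
    LevelSet (xPolyP 2 rho2') C ⊆ {N | N < 2} ∪ {N | IsSquare (psNumer 2 N)} := by
  rintro N ⟨r, -, h, -⟩
  simp only [Set.mem_union, Set.mem_setOf_eq]
  by_cases hN : N < 2
  · exact Or.inl hN
  refine Or.inr ?_
  rcases level_sq_cases (c := 17) (a := -1) (b := -1) (by decide) (by norm_num) bev_rho2'_sq (by omega) h with
    ⟨hae, -⟩ | ⟨e, -, heb, hsq⟩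
  · exact absurd hae (by decide)
  · have he1 : e = 1 := Nat.dvd_one.mp (by simpa using heb)
    simpa [he1] using hsq

/-- **`LevelFinite rho2'`** (hypothesis-free). -/
theorem levelFinite_rho2' : LevelFinite (xPolyP 2 rho2') :=
  levelFinite_sq (by decide) (by norm_num) bev_rho2'_sq

/-- **`BddLevelEmpty rho2'`** (the B-side currency). -/
theorem bddLevelEmpty_rho2' : BddLevelEmpty (xPolyP 2 rho2') :=
  (bddLevelEmpty_iff_levelFinite _).mpr levelFinite_rho2'

/-- **`ThinFibreAt m₀ rho2'` for EVERY `m₀`** — in particular at the residue qualities `m₀ ≤ 2` of `residue_rho2'`. -/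
theorem thinFibreAt_rho2' (m₀ : ℕ) : ThinFibreAt m₀ (xPolyP 2 rho2') :=
  thinFibreAt_of_levelFinite levelFinite_rho2' m₀

/-- `: ThinFibreAt 2 (xPolyP 2 rho2')`. -/
theorem thinFibreAt_two_rho2' : ThinFibreAt 2 (xPolyP 2 rho2') := thinFibreAt_rho2' 2

/-! ## §4  HEADLINE — both exhibits of record (ERRATUM E5, VERDICT 28) are typed residue members AND thin -/

/-- **NODE 29: BOTH EXHIBITS OF RECORD FALL.**  ρ1′ and ρ2′ are stratum-ρ1 / stratum-ρ2 `Residue` members at every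
quality `m₀ ≤ 2` (tree: `residue_rho1'`, `residue_rho2'`) and nevertheless `LevelFinite`, hence `ThinFibreAt m₀` at
EVERY `m₀` — hypothesis-free, by split descent (§2) resp. square descent (§3); ρ1′ has no level point at all beyond
level 3.  (Rung 0: nothing here touches `ThinFibre 2`, W4, the binders, 33364 or Schanuel.) -/
theorem exhibits_decided :
    (∀ m₀, m₀ ≤ 2 → Residue m₀ 2 rho1' ∧ Residue m₀ 2 rho2') ∧
    LevelFinite (xPolyP 2 rho1') ∧ LevelFinite (xPolyP 2 rho2') ∧
    (∀ m₀, ThinFibreAt m₀ (xPolyP 2 rho1') ∧ ThinFibreAt m₀ (xPolyP 2 rho2')) ∧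
    (∀ N, 4 ≤ N → ∀ r : ℚ, bev (xPolyP 2 rho1') (partialSum 2 N) r ≠ 0) ∧
    (∀ C : ℝ, LevelSet (xPolyP 2 rho2') C ⊆ {N | N < 2} ∪ {N | IsSquare (psNumer 2 N)}) :=
  ⟨fun _ hm => ⟨residue_rho1' hm, residue_rho2' hm⟩, levelFinite_rho1', levelFinite_rho2',
    fun m₀ => ⟨thinFibreAt_rho1' m₀, thinFibreAt_rho2' m₀⟩, fun _ hN r => no_level_rho1' hN r,
    levelSet_rho2'_subset⟩

end Summit.Schanuel.Schanuel.Theorems.RootDecomp1KExhibitDescent
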